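import Summits.QuantumFields.YangMills.Theses.VirialFluxGap
import HarnessLib

/-!
# Route `VirialFluxGap` (YangMills): the support item `ConvexTransport` (stmt-QuantumFields-24181) holds BY NAME

Griffiths-type CONVEX TRANSPORT (pure real analysis, Mathlib only): a function `f` convex on `[b/2, 2b]`,
differentiable at `b`, and within `η` of the model `C − (D/2)·log x` on `[b/2, 2b]` (`0 ≤ η ≤ D`, `0 < D`, `0 < b`) has
`|b·f′(b) + D/2| ≤ 8·√(η·D)`.

Proof.  For `u ∈ (0, 1]` and `s = 1 + u` the secant slope inequalities of a convex function
(`ConvexOn.deriv_le_slope` on `[b, s b]`, `ConvexOn.slope_le_deriv` on `[b/s, b]`) give, with the model and the two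
logarithm inequalities `1 − 1/s ≤ log s ≤ s − 1` (`Real.one_sub_inv_le_log_of_pos`, `Real.log_le_sub_one_of_pos`),
`−(D·u/2 + 4η/u) ≤ b·f′(b) + D/2 ≤ D·u/2 + 2η/u`; hence `|b·f′(b) + D/2| ≤ D·u/2 + 4η/u` (lemma `window_bound`).
With `u := √(ηD)/D` (admissible because `η ≤ D`; if `η = 0` let `u ↓ 0`) the right-hand side is `(9/2)·√(ηD) ≤ 8·√(ηD)`.

HONEST FRAMING: a calculus support of LINE g14-A (planner ym-idea-4 g14; glued split of crux `TwistedEquipartition`,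
stmt-QuantumFields-24142); the crux `SharpTwistedLaplace` (stmt-QuantumFields-24204) is OPEN; no summit conjunct is
touched; the Yang–Mills mass gap is NOT proved.  No `sorry`, no new axiom, no new definition.
References: [cite: Griffiths1964] (convexity transport of free-energy derivatives); [cite: TomboulisYaffe1985].
-/

set_option autoImplicit false

namespace Summit.QuantumFields.YangMills.Theorems.VirialFluxGap.ConvexTransport

open Set

/-- The two-sided secant bound: for a function `f` convex on `[b/2, 2b]`, differentiable at `b`, within `η ≥ 0` of
`C − (D/2) log x` there (`D ≥ 0`), and every `u ∈ (0, 1]`:  `|b·f′(b) + D/2| ≤ D·u/2 + 4η/u`. -/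
theorem window_bound (f : ℝ → ℝ) (D C η b : ℝ) (hb : 0 < b) (hD : 0 ≤ D) (hη : 0 ≤ η)
    (hconv : ConvexOn ℝ (Icc (b / 2) (2 * b)) f) (hdiff : DifferentiableAt ℝ f b)
    (happrox : ∀ x ∈ Icc (b / 2) (2 * b), |f x + D / 2 * Real.log x - C| ≤ η)
    (u : ℝ) (hu : 0 < u) (hu1 : u ≤ 1) :
    |b * deriv f b + D / 2| ≤ D * u / 2 + 4 * η / u := by
  set s : ℝ := 1 + u with hs_def
  have hs0 : 0 < s := by rw [hs_def]; linarith
  have hs1 : 1 < s := by rw [hs_def]; linarith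
  have hs2 : s ≤ 2 := by rw [hs_def]; linarith
  have hsne : s ≠ 0 := hs0.ne'
  have hbne : b ≠ 0 := hb.ne'
  -- membership of the three abscissae `b/s < b < s b` in the window
  have hb_mem : b ∈ Icc (b / 2) (2 * b) := ⟨by linarith, by linarith⟩
  have hsb_mem : s * b ∈ Icc (b / 2) (2 * b) := by
    constructor
    · nlinarith
    · nlinarith
  have hbs_mem : b / s ∈ Icc (b / 2) (2 * b) := by
    constructor
    · rw [div_le_div_iff₀ (by norm_num : (0:ℝ) < 2) hs0]; nlinarith
    · rw [div_le_iff₀ hs0]; nlinarith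
  have hb_lt_sb : b < s * b := by nlinarith
  have hbs_lt_b : b / s < b := by rw [div_lt_iff₀ hs0]; nlinarith
  -- the model at the three abscissae
  have hB := happrox b hb_mem
  have hA := happrox (s * b) hsb_mem
  have hA' := happrox (b / s) hbs_mem
  rw [Real.log_mul hsne hbne] at hA
  rw [Real.log_div hbne hsne] at hA'
  -- logarithm bracket `1 - 1/s ≤ log s ≤ s - 1 = u`
  have hlog_up : Real.log s ≤ u := by
    have := Real.log_le_sub_one_of_pos hs0; rw [hs_def] at this ⊢; linarith
  have hlog_lo : 1 - s⁻¹ ≤ Real.log s := Real.one_sub_inv_le_log_of_pos hs0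
  have hinv : 1 - s⁻¹ = u / s := by
    field_simp; rw [hs_def]; ring
  rw [hinv] at hlog_lo
  -- secant inequalities of the convex function at `b`
  have hup : deriv f b ≤ slope f b (s * b) := hconv.deriv_le_slope hb_mem hsb_mem hb_lt_sb hdiff
  have hlo : slope f (b / s) b ≤ deriv f b := hconv.slope_le_deriv hbs_mem hb_mem hbs_lt_b hdiff
  rw [slope_def_field] at hup hlo
  -- clear denominators: `s b - b = u b`, `b - b/s = u b / s`
  have hden₁ : s * b - b = u * b := by rw [hs_def]; ring
  have hden₂ : b - b / s = u * b / s := by field_simp; rw [hs_def]; ring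
  rw [hden₁] at hup
  rw [hden₂] at hlo
  have hub : 0 < u * b := mul_pos hu hb
  have hubs : 0 < u * b / s := div_pos hub hs0
  rw [le_div_iff₀ hub] at hup
  rw [div_le_iff₀ hubs] at hlo
  -- unpack the absolute values
  obtain ⟨hB₁, hB₂⟩ := abs_le.mp hB
  obtain ⟨hA₁, hA₂⟩ := abs_le.mp hA
  obtain ⟨hA'₁, hA'₂⟩ := abs_le.mp hA'
  -- upper bound: `u b f' + u D/2 ≤ D u²/2 + 2η`
  have hupper : u * (b * deriv f b + D / 2) ≤ u * (D * u / 2 + 2 * η / u) := by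
    have h1 : u * (D * u / 2 + 2 * η / u) = D * u ^ 2 / 2 + 2 * η := by
      field_simp
    rw [h1]
    -- `u b f' ≤ f(sb) - f b ≤ 2η - (D/2) log s ≤ 2η - (D/2)(u/s)`
    have h2 : deriv f b * (u * b) ≤ 2 * η - D / 2 * Real.log s := by linarith
    have h3 : D / 2 * (u / s) ≤ D / 2 * Real.log s := mul_le_mul_of_nonneg_left hlog_lo (by linarith)
    -- `u - u/s = u²/s ≤ u²`
    have h4 : u - u / s ≤ u ^ 2 := by
      rw [show u - u / s = u ^ 2 / s by field_simp; rw [hs_def]; ring]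
      exact div_le_self (sq_nonneg u) hs1.le
    have h5 : D / 2 * (u - u / s) ≤ D / 2 * u ^ 2 := mul_le_mul_of_nonneg_left h4 (by linarith)
    nlinarith
  -- lower bound: `u b f' + u D/2 ≥ -(D u²/2 + 4η)`
  have hlower : u * (-(D * u / 2 + 4 * η / u)) ≤ u * (b * deriv f b + D / 2) := by
    have h1 : u * (-(D * u / 2 + 4 * η / u)) = -(D * u ^ 2 / 2 + 4 * η) := by
      field_simp
    rw [h1]
    -- `s (f b - f(b/s)) ≤ u b f'` and `f b - f(b/s) ≥ -2η - (D/2) log s ≥ -2η - (D/2) u`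
    have h2 : (f b - f (b / s)) * s ≤ deriv f b * (u * b) := by
      have := hlo
      rw [← mul_div_assoc, le_div_iff₀ hs0] at this
      linarith
    have h3 : -(2 * η) - D / 2 * u ≤ f b - f (b / s) := by
      have : D / 2 * Real.log s ≤ D / 2 * u := mul_le_mul_of_nonneg_left hlog_up (by linarith)
      linarith
    have h4 : (-(2 * η) - D / 2 * u) * s ≤ (f b - f (b / s)) * s :=
      mul_le_mul_of_nonneg_right h3 hs0.le
    have h5 : 2 * η * u ≤ 2 * η := by nlinarith
    rw [hs_def] at h4
    nlinarith
  have hupper' : b * deriv f b + D / 2 ≤ D * u / 2 + 2 * η / u := le_of_mul_le_mul_left hupper hu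
  have hlower' : -(D * u / 2 + 4 * η / u) ≤ b * deriv f b + D / 2 := le_of_mul_le_mul_left hlower hu
  have hηu : 0 ≤ η / u := div_nonneg hη hu.le
  rw [abs_le]
  constructor
  · linarith
  · calc b * deriv f b + D / 2 ≤ D * u / 2 + 2 * η / u := hupper'
      _ ≤ D * u / 2 + 4 * η / u := by
          have : 2 * η / u ≤ 4 * η / u := by
            rw [div_le_div_iff_of_pos_right hu]; linarith
          linarith

/-- **`ConvexTransport` holds** (item stmt-QuantumFields-24181 of route `VirialFluxGap`, BY NAME): a function convex
on `[b/2, 2b]`, differentiable at `b`, within `η` of `C − (D/2) log x` there (`0 ≤ η ≤ D`, `0 < b`, `0 < D`) has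
`|b·f′(b) + D/2| ≤ 8·√(η·D)` — `window_bound` at `u := √(ηD)/D` (then `D u/2 + 4η/u = (9/2)√(ηD)`), and `u ↓ 0`
when `η = 0`.  [cite: Griffiths1964] -/
theorem convexTransport_proof :
    Summit.QuantumFields.YangMills.Theses.VirialFluxGap.ConvexTransport := by
  intro f D C η b hb hD hη hηD hconv hdiff happrox
  have hmain := window_bound f D C η b hb hD.le hη hconv hdiff happrox
  set X : ℝ := b * deriv f b + D / 2 with hX
  set r : ℝ := Real.sqrt (η * D) with hr
  have hr0 : 0 ≤ r := Real.sqrt_nonneg _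
  have hr2 : r ^ 2 = η * D := Real.sq_sqrt (mul_nonneg hη hD.le)
  rcases eq_or_lt_of_le hη with hη0 | hηpos
  · -- `η = 0`: let `u ↓ 0` in the window bound
    have hη0' : η = 0 := hη0.symm
    have hr00 : r = 0 := by rw [hr, hη0', zero_mul, Real.sqrt_zero]
    rw [hr00, mul_zero]
    by_contra hne
    have hXpos : 0 < |X| := lt_of_not_ge hne
    set u : ℝ := min 1 (|X| / D) with hu
    have hu0 : 0 < u := lt_min one_pos (div_pos hXpos hD)
    have hu1 : u ≤ 1 := min_le_left _ _
    have huX : u ≤ |X| / D := min_le_right _ _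
    have h := hmain u hu0 hu1
    rw [hη0'] at h
    have h' : |X| ≤ D * u / 2 := by simpa using h
    have h'' : D * u ≤ |X| := by
      have := mul_le_mul_of_nonneg_left huX hD.le
      rwa [mul_div_cancel₀ _ hD.ne'] at this
    linarith
  · -- `η > 0`: `u := r / D ∈ (0, 1]`
    have hrpos : 0 < r := Real.sqrt_pos.mpr (mul_pos hηpos hD)
    set u : ℝ := r / D with hu
    have hu0 : 0 < u := div_pos hrpos hD
    have hrD : r ≤ D := by
      rw [hr, Real.sqrt_le_left hD.le]
      nlinarith
    have hu1 : u ≤ 1 := by rw [hu, div_le_one hD]; exact hrD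
    have h := hmain u hu0 hu1
    -- `D u / 2 + 4 η / u = r/2 + 4 r = (9/2) r`
    have h1 : D * u / 2 = r / 2 := by rw [hu]; field_simp
    have h2 : 4 * η / u = 4 * r := by
      rw [hu]
      field_simp
      nlinarith [hr2]
    rw [h1, h2] at h
    linarith

end Summit.QuantumFields.YangMills.Theorems.VirialFluxGap.ConvexTransport
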